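import Summits.BirchSwinnertonDyer.BirchSwinnertonDyer.Theorems.AlignedTransportAtTwoMainConjectureOfRankZeroBSDAtTwoHalfDescentLayerIndexModule
import Literature.NumberTheory.EllipticCurves.IwasawaAlgebraCharAnnihilatorProofs
import HarnessLib

/-!
# Route `AlignedTransportAtTwo`, crux C2 `MainConjectureOfRankZeroBSDAtTwo` (stmt-BirchSwinnertonDyer-22298):
# THE LAYER-GROWTH NUMBER IS AN INDEX, V — THE TOWER: for `X` f.g. torsion over `Λ` WITHOUT non-zero finite submodule, `char_Λ X = (f)`, `f` coprime to `ω_n`: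
# `#(X/ω_n X) = #(X/TX) · ∏_{m<n} #(X/Ψ_m X)`, and IWASAWA'S FORMULA EXACTLY: `e_n + μp^{n₀} + λn₀ = e_{n₀} + μpⁿ + λn` for ALL `n ≥ n₀`, `n₀` = the first layer
# with `φ(p^{n₀+1}) > λ(f)` (`#(X/ω_n X) = p^{e_n}`; no structure theorem, explicit `ν` and `n₀`)

HONEST FRAMING (cell `bsd-f1-sign2`, WIDTH-5 attached prover seat `bsd-line-att-p5` gen 54 on line `birth` of the lead `bsd-line-att-p2`;
`--supports` stmt-BirchSwinnertonDyer-22298, closes nothing; BSD is NOT proved by any of this; the crux C2, its verdict «blocked-on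
`Rank1Residual.GreenbergMuConjectureIrreducible`» and every registered stub (P / T / Kμ / LimDoor / MuIneqʳ / PFμ⁺) are untouched). THEOREMS ONLY —
pure commutative algebra over `Λ = ℤ_p⟦T⟧`, any prime `p`; no `def`, no instance, no named fact, no `sorry`. Sequel of this gen's `…HalfDescentLayerRing` /
`…HalfDescentLayerIndex` / `…HalfDescentLayerIndexModule` (★★★ `natCard_layerQuotient_eq_pow`: `#(X/Ψ_n X) = p^{pⁿ(p−1)·μ(f) + λ(f)}` at every layer with
`pⁿ(p−1) > λ(f)`). Here the single-layer indices are MULTIPLIED UP the tower `ω_n = (1+T)^{pⁿ} − 1 = T·Ψ_0·Ψ_1⋯Ψ_{n−1}`.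

THE POINT. `f` kills `X` (tree `IwasawaAlgebra.smul_eq_zero_of_charIdeal_eq_span_of_noFiniteSubmodule`; also `(f) = Fitt₀(X) ⊆ Ann(X)`); so for `a ∈ Λ` with `Λ/(f, a)` FINITE the `a`-torsion `X[a]` is a finitely generated module killed by `(f, a)`, hence
finite, hence ZERO (`hnf`): `a` acts injectively on `X` (§2: `T` when `f(0) ≠ 0`; an Eisenstein distinguished `g ∤ f`, e.g. `Ψ_m ∤ f`; products). For an `X`-regular
`a` the sequence `0 → X/bX —·a→ X/abX → X/aX → 0` is exact (§1), so `#(X/abX) = #(X/aX)·#(X/bX)`. Hence: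
* ★★ `natCard_quotient_omega_eq_mul_prod`: `f(0) ≠ 0` and `Ψ_m ∤ f` for `m < n` ⟹ **`#(X/ω_n X) = #(X/TX) · ∏_{m<n} #(X/Ψ_m X)`** (all factors finite);
* ★★★ `natCard_quotient_omega_mul_pow_eq` (IWASAWA'S THEOREM, EXACT): with `n₀` such that `λ(f) < p^{n₀}(p−1)`, for every `n ≥ n₀`:
  **`#(X/ω_n X) · p^{μ(f)·p^{n₀} + λ(f)·n₀} = #(X/ω_{n₀} X) · p^{μ(f)·pⁿ + λ(f)·n}`** — i.e. `e_n = μpⁿ + λn + ν` with the EXPLICIT constant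
  `ν = e_{n₀} − μp^{n₀} − λn₀` from the EXPLICIT layer `n₀` on (Washington Thm. 13.13 has «`n ≫ 0`» and an inexplicit `ν`, via pseudo-isomorphism with an elementary
  module; here `pd_Λ X ≤ 1` + Fulton over the layer DVRs, files I–III).
Reading (g40's Pontryagin pair `X/ω_nX ≃ Hom(Sel_∞^{Γ_n}, ℚ/ℤ)`, not imported here): `#(X/ω_n X) = #Sel_{p^∞}(E/K_∞)^{Γ_n}`, so this is the growth law of the
`Γ_n`-invariants of the limit Selmer group, and — through control — of `#Sel_{p^∞}(E/ℚ_n)` in a rank-`0` tower; the sequel `…HalfDescentLayerIndexSelmer` says so.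
Memo `Cruxes/MainConjectureOfRankZeroBSDAtTwo/LAYER-INDEX-att-p5-g54.md`. BSD is not proved by any of this; nothing about any curve is asserted here.

References: K. Iwasawa, Bull. AMS 65 (1959); L. Washington, GTM 83, §13.3 (Lemmas 13.14–13.21, Thm. 13.13) [Washington1997]; J. Neukirch, A. Schmidt, K. Wingberg,
*Cohomology of Number Fields*, (5.3.17); R. Greenberg, LNM 1716 (1999), Thm. 1.10, Prop. 4.14–4.15 [GreenbergLNM1716]; B. de Smit, K. Rubin, R. Schoof, Prop. 1.1 (i)
(`Fitt ⊆ Ann`) [DeSmitRubinSchoof1997].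
-/

set_option linter.dupNamespace false
set_option autoImplicit false

noncomputable section

open scoped Classical Polynomial

namespace Summit.BirchSwinnertonDyer.BirchSwinnertonDyer.Theorems.AlignedTransportAtTwoHalfDescentLayerIndexTower

open Literature.NumberTheory.EllipticCurves Literature.NumberTheory.EllipticCurves.IwasawaAlgebra
  Literature.RingTheory.FittingIdeal
  Summit.BirchSwinnertonDyer.Rank1Residual.X1.MuLambda
  Summit.BirchSwinnertonDyer.Rank1Residual.X1.ParitySqueeze
  Summit.BirchSwinnertonDyer.Rank1Residual.X1.GeneratorBoundOrd
  Summit.BirchSwinnertonDyer.Rank1Residual.Iwasawa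
  Summit.BirchSwinnertonDyer.BirchSwinnertonDyer.Theorems.DefectPrime
  Summit.BirchSwinnertonDyer.BirchSwinnertonDyer.Theorems.AlignedTransportAtTwoCyclotomicLayerPrime
  Summit.BirchSwinnertonDyer.BirchSwinnertonDyer.Theorems.AlignedTransportAtTwoHalfDescentLayerRing
  Summit.BirchSwinnertonDyer.BirchSwinnertonDyer.Theorems.AlignedTransportAtTwoHalfDescentLayerIndex
  Summit.BirchSwinnertonDyer.BirchSwinnertonDyer.Theorems.AlignedTransportAtTwoHalfDescentLayerIndexModule

universe u

/-! ## §1 `#(M/abM) = #(M/aM)·#(M/bM)` for an `M`-regular `a` (any commutative ring) -/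

section Regular

variable {R : Type*} [CommRing R] {M : Type*} [AddCommGroup M] [Module R M]

/-- **`#(M/abM) = #(M/aM)·#(M/bM)` when `a` acts injectively on `M`**: `0 → M/bM —·a→ M/abM → M/aM → 0` is exact (`a·x ∈ abM ⟹ x ∈ bM` by
regularity). `Nat.card` throughout (so also when some quotient is infinite). [cite: Washington1997, §13.3 (Lemma 13.18 and the proof of Thm. 13.13)] -/
theorem natCard_quotient_span_mul_smul_top (a b : R) (ha : ∀ x : M, a • x = 0 → x = 0) :
    Nat.card (M ⧸ (Ideal.span {a * b} • ⊤ : Submodule R M)) =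
      Nat.card (M ⧸ (Ideal.span {a} • ⊤ : Submodule R M)) * Nat.card (M ⧸ (Ideal.span {b} • ⊤ : Submodule R M)) := by
  set A : Submodule R M := Ideal.span {a * b} • ⊤ with hA
  set B : Submodule R M := Ideal.span {a} • ⊤ with hB
  have hmemA : ∀ x : M, x ∈ A ↔ ∃ y : M, x = (a * b) • y := fun x ↦ by
    rw [hA, Submodule.ideal_span_singleton_smul, Submodule.mem_smul_pointwise_iff_exists]
    exact ⟨fun ⟨y, _, h⟩ ↦ ⟨y, h.symm⟩, fun ⟨y, h⟩ ↦ ⟨y, Submodule.mem_top, h.symm⟩⟩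
  have hmemB : ∀ x : M, x ∈ B ↔ ∃ y : M, x = a • y := fun x ↦ by
    rw [hB, Submodule.ideal_span_singleton_smul, Submodule.mem_smul_pointwise_iff_exists]
    exact ⟨fun ⟨y, _, h⟩ ↦ ⟨y, h.symm⟩, fun ⟨y, h⟩ ↦ ⟨y, Submodule.mem_top, h.symm⟩⟩
  have hmemC : ∀ x : M, x ∈ (Ideal.span {b} • ⊤ : Submodule R M) ↔ ∃ y : M, x = b • y := fun x ↦ by
    rw [Submodule.ideal_span_singleton_smul, Submodule.mem_smul_pointwise_iff_exists]
    exact ⟨fun ⟨y, _, h⟩ ↦ ⟨y, h.symm⟩, fun ⟨y, h⟩ ↦ ⟨y, Submodule.mem_top, h.symm⟩⟩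
  have hAB : A ≤ B := fun x hx ↦ by
    obtain ⟨y, rfl⟩ := (hmemA x).mp hx
    exact (hmemB _).mpr ⟨b • y, by rw [mul_smul]⟩
  -- `B/A ≅ M/bM` via `x ↦ a·x`
  set φ : M →ₗ[R] M ⧸ A := A.mkQ.comp (DistribSMul.toLinearMap R M a) with hφ
  have hφ_apply : ∀ x, φ x = A.mkQ (a • x) := fun x ↦ rfl
  have hrange : LinearMap.range φ = B.map A.mkQ := by
    apply le_antisymm
    · rintro _ ⟨x, rfl⟩
      exact ⟨a • x, (hmemB _).mpr ⟨x, rfl⟩, (hφ_apply x).symm⟩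
    · rintro _ ⟨y, hy, rfl⟩
      obtain ⟨x, rfl⟩ := (hmemB y).mp hy
      exact ⟨x, hφ_apply x⟩
  have hker : LinearMap.ker φ = (Ideal.span {b} • ⊤ : Submodule R M) := by
    ext x
    rw [LinearMap.mem_ker, hφ_apply, Submodule.mkQ_apply, Submodule.Quotient.mk_eq_zero, hmemA, hmemC]
    constructor
    · rintro ⟨y, hy⟩
      refine ⟨y, sub_eq_zero.mp (ha _ ?_)⟩
      rw [smul_sub, hy, mul_smul, sub_self]
    · rintro ⟨y, rfl⟩
      exact ⟨y, by rw [mul_smul]⟩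
  have hmap : Nat.card ↥(B.map A.mkQ) = Nat.card (M ⧸ (Ideal.span {b} • ⊤ : Submodule R M)) := by
    rw [← hrange, ← Nat.card_congr (φ.quotKerEquivRange).toEquiv, Nat.card_congr (Submodule.quotEquivOfEq _ _ hker).toEquiv]
  -- `#(M/A) = #(B/A) · #((M/A)/(B/A))`, `(M/A)/(B/A) ≅ M/B`
  rw [Submodule.card_eq_card_quotient_mul_card (B.map A.mkQ), Nat.card_congr (Submodule.quotientQuotientEquivQuotient A B hAB).toEquiv,
    hmap, mul_comm]

/-- The same with the factors written `b·a`. [cite: Washington1997, §13.3 (Lemma 13.18)] -/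
theorem natCard_quotient_span_mul_smul_top' (a b : R) (ha : ∀ x : M, a • x = 0 → x = 0) :
    Nat.card (M ⧸ (Ideal.span {b * a} • ⊤ : Submodule R M)) =
      Nat.card (M ⧸ (Ideal.span {a} • ⊤ : Submodule R M)) * Nat.card (M ⧸ (Ideal.span {b} • ⊤ : Submodule R M)) := by
  rw [mul_comm b a]
  exact natCard_quotient_span_mul_smul_top a b ha

/-- Regular elements compose: if `a` and `b` act injectively on `M`, so does `a·b`. [folklore] -/
theorem smul_eq_zero_imp_mul {a b : R} (ha : ∀ x : M, a • x = 0 → x = 0) (hb : ∀ x : M, b • x = 0 → x = 0) :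
    ∀ x : M, (a * b) • x = 0 → x = 0 := fun x h ↦ hb x (ha _ (by rw [← mul_smul]; exact h))

/-- A finitely generated module killed by an ideal of FINITE index is finite. [folklore] -/
theorem finite_of_smul_eq_zero_of_finite_quotient [Module.Finite R M] (J : Ideal R) [Finite (R ⧸ J)] (hJ : ∀ r ∈ J, ∀ x : M, r • x = 0) :
    Finite M := by
  obtain ⟨k, x, hx⟩ := Module.Finite.exists_fin (R := R) (M := M)
  let π : (Fin k → R) →ₗ[R] M := Fintype.linearCombination _ x
  have hπ : ∀ c, π c = ∑ i, c i • x i := fun c ↦ Fintype.linearCombination_apply _ _ c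
  have hsurj : Function.Surjective π := by
    rw [← LinearMap.range_eq_top, eq_top_iff, ← hx, Submodule.span_le]
    rintro _ ⟨i, rfl⟩
    refine ⟨Pi.single i 1, ?_⟩
    rw [hπ, Finset.sum_eq_single i (fun j _ hj ↦ by rw [Pi.single_eq_of_ne hj, zero_smul]) (fun hi ↦ absurd (Finset.mem_univ i) hi),
      Pi.single_eq_same, one_smul]
  have hle : (J • ⊤ : Submodule R (Fin k → R)) ≤ LinearMap.ker π := by
    refine Submodule.smul_le.mpr fun r hr v _ ↦ ?_
    rw [LinearMap.mem_ker, map_smul, hJ r hr]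
  have hsurj' : Function.Surjective ((J • ⊤ : Submodule R (Fin k → R)).liftQ π hle) := by
    intro m
    obtain ⟨v, rfl⟩ := hsurj m
    exact ⟨Submodule.Quotient.mk v, rfl⟩
  haveI : Finite ((Fin k → R) ⧸ (J • ⊤ : Submodule R (Fin k → R))) := by
    apply Nat.finite_of_card_ne_zero
    rw [Module.card_pi_quotSMulTop (fun _ : Fin k ↦ R) J, Finset.prod_const]
    refine pow_ne_zero _ ?_
    rw [Ideal.smul_eq_mul, Ideal.mul_top]
    exact Nat.card_pos.ne'
  exact Finite.of_surjective _ hsurj'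

end Regular

/-! ## §2 Regular elements on a module without finite submodule: `T` (when `f(0) ≠ 0`), an Eisenstein `g ∤ f`, and `ω_n` -/

section NoFinite

variable {p : ℕ} [hp : Fact p.Prime] {M : Type u} [AddCommGroup M] [Module (IwasawaAlgebra p) M]

/-- **An element `a` with `Λ/(f, a)` finite acts injectively on `X`** (`X` f.g. without finite submodule, killed by `f`): `X[a]` is a finitely generated module
killed by `(f, a)`, hence finite, hence `0`. [cite: GreenbergLNM1716, Prop. 4.14–4.15] [cite: Washington1997, §13.3 (Lemma 13.18)] -/
theorem smul_eq_zero_imp_of_finite_quotient [Module.Finite (IwasawaAlgebra p) M] (hnf : ∀ N : Submodule (IwasawaAlgebra p) M, Finite N → N = ⊥)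
    {f : IwasawaAlgebra p} (hf : ∀ x : M, f • x = 0) {a : IwasawaAlgebra p}
    (hfin : Finite (IwasawaAlgebra p ⧸ (Ideal.span {f} ⊔ Ideal.span {a}))) : ∀ x : M, a • x = 0 → x = 0 := by
  intro x hx
  set N : Submodule (IwasawaAlgebra p) M := Submodule.torsionBy (IwasawaAlgebra p) M a with hN
  haveI : Module.Finite (IwasawaAlgebra p) N := Module.Finite.iff_fg.mpr (IsNoetherian.noetherian N)
  have hkill : ∀ r ∈ Ideal.span {f} ⊔ Ideal.span {a}, ∀ y : N, r • y = 0 := by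
    intro r hr y
    obtain ⟨u, hu, v, hv, rfl⟩ := Submodule.mem_sup.mp hr
    obtain ⟨c, rfl⟩ := Ideal.mem_span_singleton'.mp hu
    obtain ⟨d, rfl⟩ := Ideal.mem_span_singleton'.mp hv
    apply Subtype.ext
    have hy : a • (y : M) = 0 := (Submodule.mem_torsionBy_iff a (y : M)).mp y.2
    rw [Submodule.coe_smul, Submodule.coe_zero, add_smul, mul_smul, mul_smul, hf, hy, smul_zero, smul_zero, add_zero]
  haveI : Finite N := finite_of_smul_eq_zero_of_finite_quotient (Ideal.span {f} ⊔ Ideal.span {a}) hkill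
  have hbot := hnf N inferInstance
  have hxN : x ∈ N := (Submodule.mem_torsionBy_iff a x).mpr hx
  rw [hbot] at hxN
  exact (Submodule.mem_bot _).mp hxN

/-- `#Λ/(f, g) = p^v` is a power of `p` — in particular FINITE — for an Eisenstein distinguished `g` (`g(0) = p`, prime in `Λ`) with `g ∤ f`: in the DVR
`𝒪 = Λ/(g)` (file I) `f̄ ≠ 0` is a unit times `π^v`. [cite: SerreLocalFields1979, I §6] [cite: Washington1997, §13.2] -/
theorem exists_natCard_quotient_span_sup_span_coe_eq_pow {g : ℤ_[p][X]} (hg0 : PowerSeries.constantCoeff (g : IwasawaAlgebra p) = p)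
    (hgp : Prime (g : IwasawaAlgebra p)) {f : IwasawaAlgebra p} (hgf : ¬ (g : IwasawaAlgebra p) ∣ f) :
    ∃ v : ℕ, Nat.card (IwasawaAlgebra p ⧸ (Ideal.span {f} ⊔ Ideal.span {(g : IwasawaAlgebra p)})) = p ^ v := by
  letI := isDomain_quotient hgp
  letI := isLocalRing_quotient hgp
  letI := isDiscreteValuationRing_quotient hg0 hgp
  have hirr : Irreducible (Ideal.Quotient.mk (Ideal.span {(g : IwasawaAlgebra p)}) PowerSeries.X) :=
    (IsDiscreteValuationRing.irreducible_iff_uniformizer _).mpr (maximalIdeal_quotient_eq_span_mk_X hg0 hgp)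
  have hf0 : Ideal.Quotient.mk (Ideal.span {(g : IwasawaAlgebra p)}) f ≠ 0 := by
    rw [Ne, Ideal.Quotient.eq_zero_iff_mem, Ideal.mem_span_singleton]; exact hgf
  obtain ⟨v, u, hu⟩ := IsDiscreteValuationRing.eq_unit_mul_pow_irreducible hf0 hirr
  refine ⟨v, ?_⟩
  rw [← natCard_quotient_span_mk_eq_natCard_quotient_sup, hu, Ideal.span_singleton_mul_left_unit u.isUnit]
  clear hu u hf0 hgf
  -- `#𝒪/(π^v) = p^v`
  induction v with
  | zero =>
    rw [pow_zero, Ideal.span_singleton_one, pow_zero, Nat.card_eq_one_iff_unique]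
    exact ⟨Ideal.Quotient.subsingleton_iff.mpr rfl, ⟨0⟩⟩
  | succ v ih =>
    rw [pow_succ, pow_succ]
    rw [show Nat.card ((IwasawaAlgebra p ⧸ Ideal.span {(g : IwasawaAlgebra p)}) ⧸
        Ideal.span {Ideal.Quotient.mk (Ideal.span {(g : IwasawaAlgebra p)}) PowerSeries.X ^ v *
          Ideal.Quotient.mk (Ideal.span {(g : IwasawaAlgebra p)}) PowerSeries.X}) =
        Nat.card ((IwasawaAlgebra p ⧸ Ideal.span {(g : IwasawaAlgebra p)}) ⧸
          Ideal.span {Ideal.Quotient.mk (Ideal.span {(g : IwasawaAlgebra p)}) PowerSeries.X ^ v}) *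
        Nat.card ((IwasawaAlgebra p ⧸ Ideal.span {(g : IwasawaAlgebra p)}) ⧸
          Ideal.span {Ideal.Quotient.mk (Ideal.span {(g : IwasawaAlgebra p)}) PowerSeries.X}) from ?_, ih, natCard_quotient_span_mk_X hg0]
    -- multiplicativity in the domain `𝒪` for the non-zero-divisor `π^v`
    have hreg : ∀ x : (IwasawaAlgebra p ⧸ Ideal.span {(g : IwasawaAlgebra p)}),
        (Ideal.Quotient.mk (Ideal.span {(g : IwasawaAlgebra p)}) PowerSeries.X ^ v) • x = 0 → x = 0 := fun x hx ↦ by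
      rw [smul_eq_mul, mul_eq_zero] at hx
      exact hx.resolve_left (pow_ne_zero _ (mk_X_ne_zero hg0 hgp))
    have h := natCard_quotient_span_mul_smul_top (M := IwasawaAlgebra p ⧸ Ideal.span {(g : IwasawaAlgebra p)})
      (Ideal.Quotient.mk (Ideal.span {(g : IwasawaAlgebra p)}) PowerSeries.X ^ v) (Ideal.Quotient.mk (Ideal.span {(g : IwasawaAlgebra p)}) PowerSeries.X) hreg
    simp only [Ideal.smul_eq_mul, Ideal.mul_top] at h
    exact h

/-- **An Eisenstein distinguished `g ∤ f` acts injectively on `X`** (e.g. every layer polynomial `Ψ_m` not dividing `f`).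
[cite: GreenbergLNM1716, Prop. 4.14–4.15] [cite: Washington1997, §13.3 (Lemma 13.18)] -/
theorem coe_smul_eq_zero_imp [Module.Finite (IwasawaAlgebra p) M] (hnf : ∀ N : Submodule (IwasawaAlgebra p) M, Finite N → N = ⊥)
    {f : IwasawaAlgebra p} (hf : ∀ x : M, f • x = 0) {g : ℤ_[p][X]} (hg0 : PowerSeries.constantCoeff (g : IwasawaAlgebra p) = p)
    (hgp : Prime (g : IwasawaAlgebra p)) (hgf : ¬ (g : IwasawaAlgebra p) ∣ f) : ∀ x : M, (g : IwasawaAlgebra p) • x = 0 → x = 0 := by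
  obtain ⟨v, hv⟩ := exists_natCard_quotient_span_sup_span_coe_eq_pow hg0 hgp hgf
  exact smul_eq_zero_imp_of_finite_quotient hnf hf (Nat.finite_of_card_ne_zero (by rw [hv]; exact pow_ne_zero _ hp.out.ne_zero))

/-- `#Λ/(f, T)` is finite when `f(0) ≠ 0` (`Λ/(f, T) = ℤ_p/(f(0))`, and `f(0) = p^v·unit`). [cite: Washington1997, §7.1] -/
theorem finite_quotient_span_sup_span_X {f : IwasawaAlgebra p} (h0 : PowerSeries.constantCoeff f ≠ 0) :
    Finite (IwasawaAlgebra p ⧸ (Ideal.span {f} ⊔ Ideal.span {(PowerSeries.X : IwasawaAlgebra p)})) := by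
  -- `f(0) = u · p^v`
  set c : ℤ_[p] := PowerSeries.constantCoeff f with hc
  have hcv : c = (PadicInt.unitCoeff h0 : ℤ_[p]) * (p : ℤ_[p]) ^ c.valuation := PadicInt.unitCoeff_spec h0
  -- `(f, T) = (T, C p^v)`
  have hXf : (PowerSeries.X : IwasawaAlgebra p) ∣ f - PowerSeries.C c := by
    rw [PowerSeries.X_dvd_iff, map_sub, PowerSeries.constantCoeff_C, hc, sub_self]
  obtain ⟨h, hh⟩ := hXf
  have heq : Ideal.span {f} ⊔ Ideal.span {(PowerSeries.X : IwasawaAlgebra p)} =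
      Ideal.span {(PowerSeries.X : IwasawaAlgebra p)} ⊔ Ideal.span {PowerSeries.C ((p : ℤ_[p]) ^ c.valuation)} := by
    have hu : IsUnit (PowerSeries.C ((PadicInt.unitCoeff h0 : ℤ_[p]) : ℤ_[p]) : IwasawaAlgebra p) :=
      (Units.isUnit _).map PowerSeries.C
    have hCc : (PowerSeries.C c : IwasawaAlgebra p) = PowerSeries.C ((p : ℤ_[p]) ^ c.valuation) * PowerSeries.C ((PadicInt.unitCoeff h0 : ℤ_[p]) : ℤ_[p]) := by
      rw [← map_mul, mul_comm, ← hcv]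
    have hspanC : Ideal.span {(PowerSeries.C c : IwasawaAlgebra p)} = Ideal.span {PowerSeries.C ((p : ℤ_[p]) ^ c.valuation)} := by
      rw [hCc, Ideal.span_singleton_mul_right_unit hu]
    have hf : f = PowerSeries.X * h + PowerSeries.C c := by rw [← hh]; ring
    rw [← hspanC]
    apply le_antisymm
    · refine sup_le ((Ideal.span_singleton_le_iff_mem _).mpr ?_) le_sup_left
      rw [hf]
      exact Submodule.add_mem _ (Ideal.mem_sup_left (Ideal.mem_span_singleton.mpr (dvd_mul_right _ _)))
        (Ideal.mem_sup_right (Ideal.mem_span_singleton_self _))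
    · refine sup_le le_sup_right ((Ideal.span_singleton_le_iff_mem _).mpr ?_)
      have e : (PowerSeries.C c : IwasawaAlgebra p) = f - PowerSeries.X * h := by rw [hf]; ring
      rw [e]
      exact Submodule.sub_mem _ (Ideal.mem_sup_left (Ideal.mem_span_singleton_self _))
        (Ideal.mem_sup_right (Ideal.mem_span_singleton.mpr (dvd_mul_right _ _)))
  rw [heq]
  have hX := isDistinguishedAt_X p
  haveI := free_quotient_pow p hX 1
  haveI := finite_quotient_pow p hX 1
  have h1 : Ideal.span {(PowerSeries.X : IwasawaAlgebra p)} = Ideal.span {((Polynomial.X : ℤ_[p][X]) : IwasawaAlgebra p) ^ 1} := by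
    rw [pow_one, Polynomial.coe_X]
  apply Nat.finite_of_card_ne_zero
  rw [h1, card_quotient_sup_span_C_pow]
  exact pow_ne_zero _ hp.out.ne_zero

/-- **`T` acts injectively on `X`** when `f(0) ≠ 0`. [cite: GreenbergLNM1716, Prop. 4.14–4.15 and Thm. 4.1] -/
theorem X_smul_eq_zero_imp [Module.Finite (IwasawaAlgebra p) M] (hnf : ∀ N : Submodule (IwasawaAlgebra p) M, Finite N → N = ⊥)
    {f : IwasawaAlgebra p} (hf : ∀ x : M, f • x = 0) (h0 : PowerSeries.constantCoeff f ≠ 0) :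
    ∀ x : M, (PowerSeries.X : IwasawaAlgebra p) • x = 0 → x = 0 :=
  smul_eq_zero_imp_of_finite_quotient hnf hf (finite_quotient_span_sup_span_X h0)

/-- **`ω_n = (1+T)^{pⁿ} − 1` acts injectively on `X`** when `f(0) ≠ 0` and `Ψ_m ∤ f` for all `m < n` (`ω_n = T·Ψ_0⋯Ψ_{n−1}`).
[cite: Washington1997, §13.3 (Lemma 13.18)] [cite: GreenbergLNM1716, Prop. 4.14–4.15] -/
theorem omega_smul_eq_zero_imp [Module.Finite (IwasawaAlgebra p) M] (hnf : ∀ N : Submodule (IwasawaAlgebra p) M, Finite N → N = ⊥)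
    {f : IwasawaAlgebra p} (hf : ∀ x : M, f • x = 0) (h0 : PowerSeries.constantCoeff f ≠ 0) {n : ℕ}
    (hΨ : ∀ m < n, ¬ ((((Polynomial.cyclotomic (p ^ (m + 1)) ℤ_[p]).comp (Polynomial.X + 1) : ℤ_[p][X]) : IwasawaAlgebra p) ∣ f)) :
    ∀ x : M, (((1 + PowerSeries.X : PowerSeries ℤ_[p]) ^ (p ^ n) - 1 : IwasawaAlgebra p)) • x = 0 → x = 0 := by
  induction n with
  | zero =>
    rw [pow_zero, pow_one, add_sub_cancel_left]
    exact X_smul_eq_zero_imp hnf hf h0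
  | succ n ih =>
    rw [← coe_cyclotomicLayer_mul_omega p n]
    exact smul_eq_zero_imp_mul
      (coe_smul_eq_zero_imp hnf hf (constantCoeff_cyclotomicLayer p n) (prime_coe_cyclotomic_comp p n) (hΨ n (Nat.lt_succ_self n)))
      (ih fun m hm ↦ hΨ m (hm.trans (Nat.lt_succ_self n)))

/-! ## §3 The tower: `#(X/ω_n X) = #(X/TX)·∏_{m<n} #(X/Ψ_m X)` and Iwasawa's formula with explicit `ν`, `n₀` -/

/-- ★★ **THE TOWER PRODUCT: `#(X/ω_n X) = #(X/TX) · ∏_{m<n} #(X/Ψ_m X)`** for `X` f.g. torsion without finite submodule, `char_Λ X = (f)`, `f(0) ≠ 0` and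
`Ψ_m ∤ f` (`m < n`) — i.e. `f` coprime to `ω_n`; every factor is the index of one relative layer. [cite: Washington1997, §13.3 (Lemmas 13.18–13.21)]
[cite: GreenbergLNM1716, Prop. 4.14–4.15] -/
theorem natCard_quotient_omega_eq_mul_prod [Module.Finite (IwasawaAlgebra p) M] (hM : Module.IsTorsion (IwasawaAlgebra p) M)
    (hnf : ∀ N : Submodule (IwasawaAlgebra p) M, Finite N → N = ⊥) {f : IwasawaAlgebra p} (hchar : Module.charIdeal (IwasawaAlgebra p) M = Ideal.span {f})
    (h0 : PowerSeries.constantCoeff f ≠ 0) {n : ℕ}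
    (hΨ : ∀ m < n, ¬ ((((Polynomial.cyclotomic (p ^ (m + 1)) ℤ_[p]).comp (Polynomial.X + 1) : ℤ_[p][X]) : IwasawaAlgebra p) ∣ f)) :
    Nat.card (M ⧸ (Ideal.span {((1 + PowerSeries.X : PowerSeries ℤ_[p]) ^ (p ^ n) - 1 : IwasawaAlgebra p)} • ⊤ : Submodule (IwasawaAlgebra p) M)) =
      Nat.card (M ⧸ (Ideal.span {(PowerSeries.X : IwasawaAlgebra p)} • ⊤ : Submodule (IwasawaAlgebra p) M)) *
        ∏ m ∈ Finset.range n, Nat.card (M ⧸ (Ideal.span {(((Polynomial.cyclotomic (p ^ (m + 1)) ℤ_[p]).comp (Polynomial.X + 1) : ℤ_[p][X]) :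
          IwasawaAlgebra p)} • ⊤ : Submodule (IwasawaAlgebra p) M)) := by
  have hf := smul_eq_zero_of_charIdeal_eq_span_of_noFiniteSubmodule p M hM hnf hchar
  induction n with
  | zero => rw [pow_zero, pow_one, add_sub_cancel_left, Finset.prod_range_zero, mul_one]
  | succ n ih =>
    have hΨ' : ∀ m < n, ¬ ((((Polynomial.cyclotomic (p ^ (m + 1)) ℤ_[p]).comp (Polynomial.X + 1) : ℤ_[p][X]) : IwasawaAlgebra p) ∣ f) :=
      fun m hm ↦ hΨ m (hm.trans (Nat.lt_succ_self n))
    rw [← coe_cyclotomicLayer_mul_omega p n, natCard_quotient_span_mul_smul_top' _ _ (omega_smul_eq_zero_imp hnf hf h0 hΨ'), ih hΨ',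
      Finset.prod_range_succ, mul_assoc]

/-- ★★★ **IWASAWA'S THEOREM, EXACT, for modules without finite submodule.** `X` f.g. torsion over `Λ`, NO non-zero finite submodule, `char_Λ X = (f)`, `f(0) ≠ 0`,
`Ψ_m ∤ f` for `m < n₀`, and `λ(f) < p^{n₀}(p−1)`. Then for every `n ≥ n₀`:
**`#(X/ω_n X) · p^{μ(f)·p^{n₀} + λ(f)·n₀} = #(X/ω_{n₀} X) · p^{μ(f)·pⁿ + λ(f)·n}`** — with `#(X/ω_n X) = p^{e_n}`: `e_n = μpⁿ + λn + ν` for ALL `n ≥ n₀`,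
`ν = e_{n₀} − μp^{n₀} − λn₀`. [cite: Washington1997, §13.3 Thm. 13.13] [cite: GreenbergLNM1716, Thm. 1.10 and Prop. 4.14–4.15] -/
theorem natCard_quotient_omega_mul_pow_eq [Module.Finite (IwasawaAlgebra p) M] (hM : Module.IsTorsion (IwasawaAlgebra p) M)
    (hnf : ∀ N : Submodule (IwasawaAlgebra p) M, Finite N → N = ⊥) {f : IwasawaAlgebra p} (hchar : Module.charIdeal (IwasawaAlgebra p) M = Ideal.span {f})
    (h0 : PowerSeries.constantCoeff f ≠ 0) {n₀ : ℕ}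
    (hΨ : ∀ m < n₀, ¬ ((((Polynomial.cyclotomic (p ^ (m + 1)) ℤ_[p]).comp (Polynomial.X + 1) : ℤ_[p][X]) : IwasawaAlgebra p) ∣ f))
    (hlam : lam f < p ^ n₀ * (p - 1)) {n : ℕ} (hn : n₀ ≤ n) :
    Nat.card (M ⧸ (Ideal.span {((1 + PowerSeries.X : PowerSeries ℤ_[p]) ^ (p ^ n) - 1 : IwasawaAlgebra p)} • ⊤ : Submodule (IwasawaAlgebra p) M)) *
        p ^ (mu f * p ^ n₀ + lam f * n₀) =
      Nat.card (M ⧸ (Ideal.span {((1 + PowerSeries.X : PowerSeries ℤ_[p]) ^ (p ^ n₀) - 1 : IwasawaAlgebra p)} • ⊤ : Submodule (IwasawaAlgebra p) M)) *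
        p ^ (mu f * p ^ n + lam f * n) := by
  -- `Ψ_m ∤ f` for EVERY `m`: below `n₀` by hypothesis, from `n₀` on because `λ(f) < λ(Ψ_m)`
  have hf0 : f ≠ 0 := fun h ↦ h0 (by rw [h, map_zero])
  have hΨall : ∀ m, ¬ ((((Polynomial.cyclotomic (p ^ (m + 1)) ℤ_[p]).comp (Polynomial.X + 1) : ℤ_[p][X]) : IwasawaAlgebra p) ∣ f) := by
    intro m
    by_cases hm : m < n₀
    · exact hΨ m hm
    · rintro ⟨q, hq⟩
      have hq0 : q ≠ 0 := fun h ↦ hf0 (by rw [hq, h, mul_zero])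
      have hl := lam_mul (prime_coe_cyclotomic_comp p m).ne_zero hq0
      rw [← hq, lam_cyclotomicLayer] at hl
      have hmono : p ^ n₀ * (p - 1) ≤ p ^ m * (p - 1) := Nat.mul_le_mul_right _ (Nat.pow_le_pow_right hp.out.pos (by omega))
      omega
  induction n, hn using Nat.le_induction with
  | base => rfl
  | succ n hmn ih =>
    have hprod := natCard_quotient_omega_eq_mul_prod hM hnf hchar h0 (n := n + 1) (fun m _ ↦ hΨall m)
    have hprod' := natCard_quotient_omega_eq_mul_prod hM hnf hchar h0 (n := n) (fun m _ ↦ hΨall m)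
    rw [Finset.prod_range_succ, ← mul_assoc, ← hprod',
      natCard_layerQuotient_eq_pow hM hnf hchar (hlam.trans_le (Nat.mul_le_mul_right _ (Nat.pow_le_pow_right hp.out.pos hmn)))] at hprod
    -- `e_{n+1} = e_n + (pⁿ(p−1)μ + λ)`; bookkeeping of exponents
    have key : Nat.card (M ⧸ (Ideal.span {((1 + PowerSeries.X : PowerSeries ℤ_[p]) ^ (p ^ (n + 1)) - 1 : IwasawaAlgebra p)} • ⊤ :
        Submodule (IwasawaAlgebra p) M)) * p ^ (mu f * p ^ n₀ + lam f * n₀) =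
      Nat.card (M ⧸ (Ideal.span {((1 + PowerSeries.X : PowerSeries ℤ_[p]) ^ (p ^ n) - 1 : IwasawaAlgebra p)} • ⊤ :
        Submodule (IwasawaAlgebra p) M)) * p ^ (mu f * p ^ n₀ + lam f * n₀) * p ^ (p ^ n * (p - 1) * mu f + lam f) := by
      rw [hprod]; ring
    rw [key, ih, mul_assoc, ← pow_add]
    congr 2
    have hp1 : 1 ≤ p := hp.out.one_lt.le
    have e : p ^ (n + 1) = p ^ n * (p - 1) + p ^ n := by
      have h2 : p ^ n * (p - 1) + p ^ n = p ^ n * (p - 1 + 1) := by ring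
      rw [h2, Nat.sub_add_cancel hp1, pow_succ]
    rw [e]
    ring

end NoFinite

end Summit.BirchSwinnertonDyer.BirchSwinnertonDyer.Theorems.AlignedTransportAtTwoHalfDescentLayerIndexTower

end
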